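import Summits.HodgeConjecture.HodgeConjecture.Theses.LinearSystemTorelli
import Summits.HodgeConjecture.HodgeConjecture.Theorems.LinearSystemTorelliTranscendentalOrSupportedStubPerpSubHodge
import Literature.AlgebraicGeometry.HodgeTheory.ComplexGysinHodgeType
import Literature.AlgebraicGeometry.HodgeTheory.ComplexConjugationHolds
import Literature.AlgebraicGeometry.HodgeTheory.HodgeTypeConjugation

/-!
# Crux `TranscendentalOrSupported` (stmt-HodgeConjecture-10853), line `Sketch` — stub `stub_rankOne`:
# rank-one constituents of a rationally spanned sub-Hodge structure are Hodge lines

Helper file for the line skeleton (v4, isotypic split) of the crux `TranscendentalOrSupported` of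
route `LinearSystemTorelli` (GHC(2p, coniveau 1) in Grothendieck's sub-Hodge form), registered stub
`stub_rankOne`. Notation: `X` smooth projective of dimension `n` over `ℂ`, `A` a Hodge model of `X`
(`A.pullback k : Hᵏ(X(ℂ); ℂ) → Hᵏ(X^an; ℂ)` the bijective comparison, `A.hodgePQ k a d` the piece
`H^{a,d}` of the model), `W ⊆ H²ᵐ(X(ℂ); ℂ)` a complex subspace.

CLAIM (`stub_rankOne`). If `W` is spanned by its rational classes
(`span ℂ {x ∈ W | x rational} = W`), its pull-back to `A` is a sub-Hodge structure
(`W.map A^* = ⨆_{p'+q'=2m} W.map A^* ⊓ H^{p',q'}`) and `dim_ℂ W = 1`, then `W = ℂ·w` for a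
RATIONAL class `w` of type `(m, m)`.

PROOF (Voisin I, §7.3.1 with Cor. 6.12 and Cor. 6.14).
* A rational generator (`stub_rankOne`, steps (1)–(2)): `W ≠ ⊥` (its dimension is `1`), so not all
  rational classes of `W` vanish (they span `W`); a non-zero rational `w ∈ W` spans the line `W`
  (`finrank_span_singleton`, `Submodule.eq_of_le_of_finrank_le`).
* A pure type (`rankOne_exists_hodgeType`): write `w = Σ_{a+d=2m} z(a,d)` with `A^* z(a,d) ∈ H^{a,d}`
  (`HodgeModel.exists_sum_eq_of_hodgeDecomposition`); the components of a class of a sub-Hodge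
  structure lie in it (`perpSubHodge_component_mem`), so `z(a,d) ∈ W = ℂ·w`, `z(a,d) = t • w`; some
  `z(a,d) ≠ 0` (their sum is `w ≠ 0`), whence `t ≠ 0` and `A^* w = t⁻¹ • A^* z(a,d) ∈ H^{a,d}`.
* Reality and Hodge symmetry (`stub_rankOne`, steps (4)–(5)): `conj w = w`
  (`IsRationalClass.conjClass_eq`) and `conj` commutes with `A^*` (`HodgeModel.pullback_conjClass`),
  so `A^* w = conj (A^* w) ∈ conj H^{a,d} ⊆ H^{d,a}` (EVERY Hodge model of a smooth projective
  variety is Hodge symmetric, `HodgeModel.isHodgeSymmetric`). Two distinct pieces of the Hodge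
  decomposition meet in `0` (`rankOne_disjoint_hodgePQ`, field `HodgeModel.isInternal_hodgePQ`
  transported along the de Rham comparison), and `A^* w ≠ 0` (`HodgeModel.pullback_injective`), so
  `(a, d) = (d, a)`, `a = d = m`.

Pure tree theorems; no named fact is taken as a hypothesis and none is introduced.

References: C. Voisin, *Hodge Theory and Complex Algebraic Geometry I* (CUP 2002), §6.1.3
Cor. 6.12 and Cor. 6.14, Thm. 6.18, §7.1.1, §7.3.1 (Lemma 7.25 and the remark after Lemma 7.26);
A. Grothendieck, *Hodge's general conjecture is false for trivial reasons*, Topology 8 (1969),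
p. 300.
-/

-- `Summit.HodgeConjecture.HodgeConjecture.Theorems` is the mandated namespace (single-conjunct summit:
-- Sub = Summit), which `linter.dupNamespace` flags on every declaration; the lakefile turns the
-- linter off tree-wide (weak option), restated here so stand-alone elaboration is warning-free too.
set_option linter.dupNamespace false

noncomputable section

namespace Summit.HodgeConjecture.HodgeConjecture.Theorems

open CategoryTheory
open Literature.AlgebraicGeometry.HodgeTheory Literature.AlgebraicGeometry.Motives
open Literature.AlgebraicTopology.SingularHomology
-- `Finset.antidiagonal` alone resolves to the `Set.IsPWO` antidiagonal of `Data.Finset.MulAntidiagonal`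
open Finset.HasAntidiagonal (antidiagonal mem_antidiagonal)

variable {n : ℕ} {X : SchemeOver ℂ}

/-! ### Two Hodge-model lemmas -/

/-- **Two distinct pieces of the Hodge decomposition meet in `0`**: for a Hodge model `A` of `X`
and `(a, d) ≠ (a', d')` with `a + d = a' + d' = k`, `H^{a,d} ⊓ H^{a',d'} = 0` in `Hᵏ(X^an; ℂ)` — the
pieces `H^{a,d}`, `a + d = k`, are independent (field `HodgeModel.isInternal_hodgePQ`, transported
along the de Rham comparison `A.deRham`; Voisin I Cor. 6.14: "a class of two different types is
zero"). [cite: VoisinHodgeI2002, Thm. 6.18 and Cor. 6.14] -/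
theorem rankOne_disjoint_hodgePQ (A : HodgeModel n X) (k : ℕ) {a d a' d' : ℕ} (had : a + d = k)
    (had' : a' + d' = k) (hne : (a, d) ≠ (a', d')) :
    Disjoint (A.hodgePQ k a d) (A.hodgePQ k a' d') := by
  have hind : iSupIndep fun pq : ↥(antidiagonal k) ↦ A.hodgePQ k pq.1.1 pq.1.2 :=
    (iSupIndep_map_orderIso_iff (Submodule.orderIsoMapComap (A.deRham A.carrier k))).2
      (A.isInternal_hodgePQ k).submodule_iSupIndep
  have hne' : (⟨(a, d), mem_antidiagonal.2 had⟩ : ↥(antidiagonal k)) ≠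
      ⟨(a', d'), mem_antidiagonal.2 had'⟩ := fun h ↦ hne (congrArg Subtype.val h)
  have h := hind.pairwiseDisjoint hne'
  rw [Function.onFun] at h
  exact h

/-- **The generator of a sub-Hodge line has a pure type.** Let `A` be a Hodge model of `X` and
`W = ℂ·w ⊆ Hᵏ(X(ℂ); ℂ)`, `w ≠ 0`, a line whose pull-back `W.map A^*` is a sub-Hodge structure
(`W.map A^* = ⨆_{p'+q'=k} W.map A^* ⊓ H^{p',q'}`). Then `A^* w ∈ H^{a,d}` for some `a + d = k`:
writing `w = Σ_{a+d=k} z(a,d)` with `A^* z(a,d) ∈ H^{a,d}`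
(`HodgeModel.exists_sum_eq_of_hodgeDecomposition`), every component lies in `W`
(`perpSubHodge_component_mem`), so `z(a,d) = t • w`; a non-zero component (the sum is `w ≠ 0`) has
`t ≠ 0`, and `A^* w = t⁻¹ • A^* z(a,d) ∈ H^{a,d}`.
[cite: VoisinHodgeI2002, §7.3.1 (Lemma 7.25 and the remark after Lemma 7.26)] -/
theorem rankOne_exists_hodgeType (A : HodgeModel n X) {k : ℕ} {W : Submodule ℂ (complexBetti X k)}
    (hW : W.map (A.pullback k).hom =
      ⨆ (p' : ℕ) (q' : ℕ) (_ : p' + q' = k), W.map (A.pullback k).hom ⊓ A.hodgePQ k p' q')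
    {w : complexBetti X k} (hw : Submodule.span ℂ {w} = W) (hw0 : w ≠ 0) :
    ∃ a d : ℕ, a + d = k ∧ A.pullback k w ∈ A.hodgePQ k a d := by
  -- the Hodge components of `w` lie in `W = ℂ·w`
  obtain ⟨z, hz, hzt⟩ := A.exists_sum_eq_of_hodgeDecomposition k w
  have hwW : w ∈ W := by
    rw [← hw]
    exact Submodule.mem_span_singleton_self w
  have hzW : ∀ i ∈ antidiagonal k, z i ∈ W := perpSubHodge_component_mem A hW hwW hz hzt
  -- some component is non-zero
  have hsum0 : ∑ i ∈ antidiagonal k, z i ≠ 0 := by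
    rw [hz]
    exact hw0
  obtain ⟨i, hi, hzi⟩ := Finset.exists_ne_zero_of_sum_ne_zero hsum0
  refine ⟨i.1, i.2, mem_antidiagonal.1 hi, ?_⟩
  -- `z i = t • w` with `t ≠ 0`, so `w = t⁻¹ • z i` is of type `(i.1, i.2)`
  have hzi' : z i ∈ Submodule.span ℂ {w} := by
    rw [hw]
    exact hzW i hi
  obtain ⟨t, ht⟩ := Submodule.mem_span_singleton.1 hzi'
  have ht0 : t ≠ 0 := by
    rintro rfl
    exact hzi (by rw [← ht, zero_smul])
  have hwt : w = t⁻¹ • z i := by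
    rw [← ht, smul_smul, inv_mul_cancel₀ ht0, one_smul]
  rw [hwt, map_smul]
  exact Submodule.smul_mem _ _ (hzt i hi)

/-! ### The stub -/

/-- **STUB `stub_rankOne` (rank-one constituents are Hodge lines) of the crux
`TranscendentalOrSupported`, line `Sketch`.** For `X` smooth projective of dimension `n`, a Hodge
model `A`, and a LINE `W ⊆ H²ᵐ(X(ℂ); ℂ)` (`dim_ℂ W = 1`) spanned by its rational classes whose
pull-back to `A` is a sub-Hodge structure: `W = ℂ·w` for a RATIONAL class `w` with
`A^* w ∈ H^{m,m}`. Proof: (1) some rational `w ∈ W` is non-zero (else the spanning set is `⊆ {0}`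
and `W = ⊥` has dimension `0`); (2) it spans `W` (`finrank_span_singleton`,
`Submodule.eq_of_le_of_finrank_le`); (3) `A^* w` has a pure type `(a, d)`, `a + d = 2m`
(`rankOne_exists_hodgeType`); (4) `w` is real (`IsRationalClass.conjClass_eq`), conjugation
commutes with `A^*` (`HodgeModel.pullback_conjClass`) and `A` is Hodge symmetric
(`HodgeModel.isHodgeSymmetric hX A`), so `A^* w = conj (A^* w) ∈ H^{d,a}` as well; (5) distinct
pieces are disjoint (`rankOne_disjoint_hodgePQ`) and `A^* w ≠ 0` (`HodgeModel.pullback_injective`),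
so `a = d = m`. [cite: VoisinHodgeI2002, §6.1.3 Cor. 6.12 and Cor. 6.14, §7.3.1] -/
theorem stub_rankOne :
    ∀ ⦃n : ℕ⦄ ⦃X : SchemeOver ℂ⦄ (hX : IsSmoothProjective n X) (A : HodgeModel n X) (m : ℕ)
    (W : Submodule ℂ (complexBetti X (2 * m))),
    Submodule.span ℂ {x : complexBetti X (2 * m) | x ∈ W ∧ IsRationalClass x} = W →
    W.map (A.pullback (2 * m)).hom =
      ⨆ (p' : ℕ) (q' : ℕ) (_ : p' + q' = 2 * m),
        W.map (A.pullback (2 * m)).hom ⊓ A.hodgePQ (2 * m) p' q' →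
    Module.finrank ℂ W = 1 →
    ∃ w : complexBetti X (2 * m), IsRationalClass w ∧
      A.pullback (2 * m) w ∈ A.hodgePQ (2 * m) m m ∧ Submodule.span ℂ {w} = W := by
  intro n X hX A m W hrat hsub hrank
  -- (1) a non-zero rational class of `W`
  obtain ⟨w, hwW, hwrat, hw0⟩ : ∃ w ∈ W, IsRationalClass w ∧ w ≠ 0 := by
    by_contra h
    have hbot : W = ⊥ := by
      rw [← hrat, Submodule.span_eq_bot]
      rintro x ⟨hxW, hxr⟩
      by_contra hx0
      exact h ⟨x, hxW, hxr, hx0⟩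
    rw [hbot, finrank_bot] at hrank
    exact zero_ne_one hrank
  -- (2) it spans the line `W`
  have hspan : Submodule.span ℂ {w} = W := by
    haveI : Module.Finite ℂ W := Module.finite_of_finrank_eq_succ hrank
    refine Submodule.eq_of_le_of_finrank_le
      (Submodule.span_le.2 (Set.singleton_subset_iff.2 hwW)) ?_
    rw [hrank, finrank_span_singleton hw0]
  refine ⟨w, hwrat, ?_, hspan⟩
  -- (3) `A^* w` has a pure type `(a, d)`, `a + d = 2m`
  obtain ⟨a, d, had, htyp⟩ := rankOne_exists_hodgeType A hsub hspan hw0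
  -- (4) and type `(d, a)` too: `w` is real and `A` is Hodge symmetric
  have htyp' : A.pullback (2 * m) w ∈ A.hodgePQ (2 * m) d a := by
    have h := A.isHodgeSymmetric hX (2 * m) a d _ htyp
    rwa [← A.pullback_conjClass, hwrat.conjClass_eq] at h
  -- (5) distinct pieces are disjoint and `A^* w ≠ 0`, so `a = d = m`
  have had' : a = d := by
    by_contra hne
    have hdis : Disjoint (A.hodgePQ (2 * m) a d) (A.hodgePQ (2 * m) d a) :=
      rankOne_disjoint_hodgePQ A (2 * m) had (by omega) fun h ↦ hne (congrArg Prod.fst h)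
    have h0 : A.pullback (2 * m) w = 0 := Submodule.disjoint_def.1 hdis _ htyp htyp'
    exact hw0 (A.pullback_injective (2 * m) (by rw [h0, map_zero]))
  have ham : a = m := by omega
  have hdm : d = m := by omega
  rw [ham, hdm] at htyp
  exact htyp

end Summit.HodgeConjecture.HodgeConjecture.Theorems

end
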